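import Literature.MathematicalPhysics.QuantumFieldTheory.Balaban1983to89.Beta.SquareTable

/-!
# `BalabanUV.Beta.D1BFx.ShellStencils` — road «BF-x» for binder row D1, sub-leaf C3-SHELL (companion):
# STENCIL BOOKKEEPING OF an3's REALISED TABLE FOR THE DESIGNATED SET `{inr true}`

HONEST DEPENDENCY (page 1, mandatory): continuum YM on T⁴ ⇐ BetaPertH ∧ nine spine estimates (0/9 proved); BetaPertH ⇐ (D1) ∧
(D4) ∧ CAP+tail; G-an2-4 gates asym, D1 and NE2/3/4.  HONEST FRAMING (cell contract, verbatim): «discharging `BetaPertH` makes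
Bałaban's UV stability UNCONDITIONAL — a real constructive-QFT result; it is NOT the continuum limit and NOT the Clay problem.»
THIS MODULE DISCHARGES NOTHING of the wall: [folklore] case analysis on the six indices of an3's realised table (`SquareTable.stP/stQ`,
`bfP/bfQ`) and three lines of real arithmetic, composed BY NAME from `SquareTable` (`decay_le_pow`, `pow_shift_le`, `two_le_bfQ_a`),
`TwoPowerLegs.supNorm_*`, `TransferUV.card_annulus_succ_four_le`.  No `def`, no `Prop` mirror, no cited fact, 0 sorry.  0 wall binders
instantiated; NOT D1, NOT `BetaPertH`, NOT continuum, NOT Clay.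

ABSOLUTE RULE (cell charter, verbatim): «No internally-minted statement may enter as a cited fact. Every hypothesis is either
kernel-proved in this package or a verbatim quotation of a PUBLISHED theorem with page reference. The manuscript(s) under audit are NOT
citable for their own disputed steps — they are the thing under adjudication; programme-internal (2001/route/tribunal) claims are never
citable.»  Nothing below is a statement about Bałaban's kernels.

WHY (journal CLAIM l.11259).  In an3's realised table (`SquareTable` §10: first stencils `stP = (D_{μν}G, D_{μν}G, F_μG, F_μG | G, F_μG)`,
second stencils `stQ = (G(·+e_μ+e_ν), G(·+e_ν), F_νG(·+e_μ), F_νG | D_{μν}G, F_νG)`) the MIXED second difference is the first leg of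
`inl 0`, `inl 1` and the second leg of the ghost index `inr true`; every other leg is a value or a first difference.  The scalar wall in
shell currency (`D1BFx/ShellGradedRoad`) designates `{inr true}` (first leg pointwise-good) and needs, off that index, bounds on the SECOND
stencils that use NO second-difference input — stated here.
* `stP_inr_true`, `stQ_inr_true`, `a_bfP_inr_true(_sub)`, `a_bfQ_inr_true(_sub)` (the ghost index: value / mixed difference, degrees 2 / 4);
* `stP_low` (off `inr true` the first stencil is the mixed difference at `w`, degree 4, or the forward `μ`-difference at `w`, degree 3);
* `abs_stQ_low_le` (off `inr true` the second stencil is bounded by `e_{b_i−2}` from value/gradient bounds at the four corners ONLY),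
  `abs_stQ_low_le_of_decay` (its exterior form: an3's `abs_stQ_le_of_decay` without the `d2` input);
* `shell_sum_le_of_pointwise` (`#shell ≤ 80(r+1)³`), `window_shape_le`, `tail_shape_le`, `grad_shape_le` (the real arithmetic of the row shapes).
Unit `b2b-balaban-beta-d1-formalise-leaf-07` (gen 4), D1 formalisation swarm; `LEAVES-BFx.md` sub-row C3-SHELL.
-/

namespace Summit.QuantumFields.BalabanUV.Beta.D1BFx.ShellStencils

open Finset
open scoped BigOperators
open Literature.Probability.LatticeModels (annulus)
open Literature.MathematicalPhysics.QuantumFieldTheory.Balaban1983to89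
open Literature.MathematicalPhysics.QuantumFieldTheory.Balaban1983to89.Beta
open Literature.MathematicalPhysics.QuantumFieldTheory.Balaban1983to89.Beta.DyadicShell (Pt toReal supNorm mem_annulus_iff
  ne_zero_of_mem_annulus supNorm_eq_of_mem_sphere supNorm_eq_zero_iff)
open Literature.MathematicalPhysics.QuantumFieldTheory.Balaban1983to89.Beta.BubbleTransfer (Leg unitVec)
open Literature.MathematicalPhysics.QuantumFieldTheory.Balaban1983to89.Beta.TwoPowerLegs (supNorm_sub_le_supNorm_add supNorm_unitVec
  supNorm_unitVec_add)
open Literature.MathematicalPhysics.QuantumFieldTheory.Balaban1983to89.Beta.GhostTable (gFree ghostP ghostQ)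
open Literature.MathematicalPhysics.QuantumFieldTheory.Balaban1983to89.Beta.SquareTable (BfIdx bfCoeff bfP bfQ sqP sqQ
  stP stQ two_le_bfQ_a decay_le_pow pow_shift_le)

noncomputable section

section Stencils

variable {μ ν : Fin 4}

/-- [folklore] the ghost index's first stencil is the value `G w`. -/
theorem stP_inr_true (G : Pt → ℝ) (w : Pt) : stP μ ν G (Sum.inr true) w = G w := by
  simp [stP]

/-- [folklore] the ghost index's second stencil is the mixed second difference at `w`. -/
theorem stQ_inr_true (G : Pt → ℝ) (w : Pt) :
    stQ μ ν G (Sum.inr true) w = G (w + unitVec ν + unitVec μ) - G (w + unitVec ν) - G (w + unitVec μ) + G w := by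
  simp [stQ]

/-- [folklore] degrees at the ghost index: `2` and `4`. -/
theorem a_bfP_inr_true (hμν : μ ≠ ν) : (bfP hμν (Sum.inr true)).a = 2 := by
  simp [bfP, ghostP]

/-- [folklore] (the same, shifted by the `L⁻²` gain's two powers). -/
theorem a_bfP_inr_true_sub (hμν : μ ≠ ν) : (bfP hμν (Sum.inr true)).a - 2 = 0 := by
  simp [bfP, ghostP]

/-- [folklore] (second leg). -/
theorem a_bfQ_inr_true (hμν : μ ≠ ν) : (bfQ hμν (Sum.inr true)).a = 4 := by
  simp [bfQ, ghostQ]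

/-- [folklore] (second leg, shifted). -/
theorem a_bfQ_inr_true_sub (hμν : μ ≠ ν) : (bfQ hμν (Sum.inr true)).a - 2 = 2 := by
  simp [bfQ, ghostQ]

/-- [folklore] **FIRST STENCILS OFF THE GHOST INDEX**: the mixed second difference at `w` (indices `inl 0`, `inl 1`; degree `4`) or the
forward `μ`-difference at `w` (indices `inl 2`, `inl 3`, `inr false`; degree `3`). -/
theorem stP_low (hμν : μ ≠ ν) (i : BfIdx) (hi : i ≠ Sum.inr true) (G : Pt → ℝ) :
    ((∀ w, stP μ ν G i w = G (w + unitVec ν + unitVec μ) - G (w + unitVec ν) - G (w + unitVec μ) + G w) ∧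
        (bfP hμν i).a - 2 = 2 ∧ (bfP hμν i).a = 4) ∨
      ((∀ w, stP μ ν G i w = G (w + unitVec μ) - G w) ∧ (bfP hμν i).a - 2 = 1 ∧ (bfP hμν i).a = 3) := by
  rcases i with i | b
  · fin_cases i
    · exact Or.inl ⟨fun w => by simp [stP], by simp [bfP, sqP], by simp [bfP, sqP]⟩
    · exact Or.inl ⟨fun w => by simp [stP], by simp [bfP, sqP], by simp [bfP, sqP]⟩
    · exact Or.inr ⟨fun w => by simp [stP], by simp [bfP, sqP], by simp [bfP, sqP]⟩
    · exact Or.inr ⟨fun w => by simp [stP], by simp [bfP, sqP], by simp [bfP, sqP]⟩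
  · cases b
    · exact Or.inr ⟨fun w => by simp [stP], by simp [bfP, ghostP], by simp [bfP, ghostP]⟩
    · exact absurd rfl hi

/-- [folklore] **SECOND STENCILS OFF THE GHOST INDEX ARE VALUES OR FIRST DIFFERENCES** at the four corners `w, w+e_μ, w+e_ν, w+e_μ+e_ν`
(LOCAL form, no second-difference input): `|stQ E i w| ≤ e_{b_i−2}` from `|E(w+e_μ+e_ν)|, |E(w+e_ν)| ≤ e₀` and
`|E(w+e_μ+e_ν) − E(w+e_μ)|, |E(w+e_ν) − E(w)| ≤ e₁`. -/
theorem abs_stQ_low_le (hμν : μ ≠ ν) (i : BfIdx) (hi : i ≠ Sum.inr true) (E : Pt → ℝ) (w : Pt) {e : ℕ → ℝ}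
    (h0a : |E (w + (unitVec μ + unitVec ν))| ≤ e 0) (h0b : |E (w + unitVec ν)| ≤ e 0)
    (h1a : |E (w + (unitVec μ + unitVec ν)) - E (w + unitVec μ)| ≤ e 1) (h1b : |E (w + unitVec ν) - E w| ≤ e 1) :
    |stQ μ ν E i w| ≤ e ((bfQ hμν i).a - 2) := by
  rcases i with i | b
  · fin_cases i
    · simpa [stQ, bfQ, sqQ] using h0a
    · simpa [stQ, bfQ, sqQ] using h0b
    · simpa [stQ, bfQ, sqQ] using h1a
    · simpa [stQ, bfQ, sqQ] using h1b
  · cases b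
    · simpa [stQ, bfQ, ghostQ] using h1b
    · exact absurd rfl hi

/-- [folklore] **EXTERIOR FORM** (an3's `abs_stQ_le_of_decay` WITHOUT the `d2` input, off the ghost index): from the value and gradient
decay `|G(v)| ≤ A₀e^{−c‖v‖}‖v‖⁻²`, `|∇G(v)| ≤ A₁e^{−c‖v‖}‖v‖⁻³` (`v ≠ 0`), on the shell `‖w‖∞ = r+1`, `r ≥ 1`:
`|stQ G i w| ≤ A_{b_i−2}·2^{b_i}/(r+1)^{b_i}` (the corners `w + s`, `‖s‖∞ ≤ 1`, have `‖w+s‖∞ ≥ r`; exponential dropped). -/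
theorem abs_stQ_low_le_of_decay (hμν : μ ≠ ν) (i : BfIdx) (hi : i ≠ Sum.inr true) {G : Pt → ℝ} {A : ℕ → ℝ} {c : ℝ}
    (hA : ∀ j, 0 ≤ A j) (hc : 0 ≤ c)
    (d0 : ∀ v : Pt, v ≠ 0 → |G v| ≤ A 0 * Real.exp (-c * supNorm v) / (supNorm v : ℝ) ^ 2)
    (d1 : ∀ v : Pt, v ≠ 0 → ∀ ρ : Fin 4, |G (v + unitVec ρ) - G v| ≤ A 1 * Real.exp (-c * supNorm v) / (supNorm v : ℝ) ^ 3)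
    {r : ℕ} (hr : 1 ≤ r) {w : Pt} (hw : w ∈ annulus 4 r (r + 1)) :
    |stQ μ ν G i w| ≤ A ((bfQ hμν i).a - 2) * 2 ^ (bfQ hμν i).a / ((r : ℝ) + 1) ^ (bfQ hμν i).a := by
  have hsup : (supNorm w : ℝ) = (r : ℝ) + 1 := by rw [supNorm_eq_of_mem_sphere hw]; push_cast; ring
  have hr0 : (0 : ℝ) < (r : ℝ) := by exact_mod_cast hr
  have hr1 : (1 : ℝ) ≤ (r : ℝ) := by exact_mod_cast hr
  have hge : ∀ s : Pt, (supNorm s : ℝ) ≤ 1 → (r : ℝ) ≤ supNorm (w + s) ∧ w + s ≠ 0 := by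
    intro s hs
    have h := supNorm_sub_le_supNorm_add w s
    have hge : (r : ℝ) ≤ supNorm (w + s) := by linarith
    refine ⟨hge, fun h0 => ?_⟩
    rw [h0] at hge
    simp at hge
    linarith
  have bnd : ∀ (j : ℕ) (s : Pt), (supNorm s : ℝ) ≤ 1 →
      A j * Real.exp (-c * supNorm (w + s)) / (supNorm (w + s) : ℝ) ^ (j + 2) ≤ A j / (r : ℝ) ^ (j + 2) :=
    fun j s hs => decay_le_pow (j + 2) (hA j) hc hr0 (hge s hs).1
  have hs0 : (supNorm (0 : Pt) : ℝ) ≤ 1 := by simp [supNorm_eq_zero_iff.mpr rfl]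
  have hsμ : (supNorm (unitVec μ : Pt) : ℝ) ≤ 1 := by rw [supNorm_unitVec]; simp
  have hsν : (supNorm (unitVec ν : Pt) : ℝ) ≤ 1 := by rw [supNorm_unitVec]; simp
  have hsμν : (supNorm (unitVec μ + unitVec ν : Pt) : ℝ) ≤ 1 := by rw [supNorm_unitVec_add hμν]; simp
  have e0a : |G (w + (unitVec μ + unitVec ν))| ≤ A 0 / (r : ℝ) ^ (0 + 2) :=
    (d0 _ (hge _ hsμν).2).trans (bnd 0 _ hsμν)
  have e0b : |G (w + unitVec ν)| ≤ A 0 / (r : ℝ) ^ (0 + 2) := (d0 _ (hge _ hsν).2).trans (bnd 0 _ hsν)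
  have e1a : |G (w + (unitVec μ + unitVec ν)) - G (w + unitVec μ)| ≤ A 1 / (r : ℝ) ^ (1 + 2) := by
    have h := (d1 _ (hge _ hsμ).2 ν).trans (bnd 1 _ hsμ)
    simpa [add_assoc] using h
  have e1b : |G (w + unitVec ν) - G w| ≤ A 1 / (r : ℝ) ^ (1 + 2) := by
    have h := (d1 _ (hge _ hs0).2 ν).trans (bnd 1 _ hs0)
    simpa using h
  have key := abs_stQ_low_le hμν i hi G w (e := fun j => A j / (r : ℝ) ^ (j + 2)) e0a e0b e1a e1b
  have ha : (bfQ hμν i).a - 2 + 2 = (bfQ hμν i).a := Nat.sub_add_cancel (two_le_bfQ_a hμν i)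
  simp only [ha] at key
  exact key.trans (pow_shift_le _ (hA _) hr1)

/-- [folklore] `#shell ≤ 80(r+1)³`: a pointwise bound `B` on a shell sums to `≤ 80(r+1)³·B`. -/
theorem shell_sum_le_of_pointwise {f : Pt → ℝ} {B : ℝ} {r : ℕ} (hB : 0 ≤ B)
    (h : ∀ w ∈ annulus 4 r (r + 1), |f w| ≤ B) : ∑ w ∈ annulus 4 r (r + 1), |f w| ≤ 80 * ((r : ℝ) + 1) ^ 3 * B := by
  calc ∑ w ∈ annulus 4 r (r + 1), |f w| ≤ ∑ _w ∈ annulus 4 r (r + 1), B := Finset.sum_le_sum h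
    _ = ((annulus 4 r (r + 1)).card : ℝ) * B := by rw [Finset.sum_const, nsmul_eq_mul]
    _ ≤ 80 * ((r : ℝ) + 1) ^ 3 * B := mul_le_mul_of_nonneg_right (TransferUV.card_annulus_succ_four_le r) hB

/-- [folklore] arithmetic of the window shell-row shape at degree `4`: `a/n ≤ c·t⁴/(t⁴·n)` when `a ≤ c`. -/
theorem window_shape_le {a c t n : ℝ} (ht : 0 < t) (hn : 0 < n) (hac : a ≤ c) : a / n ≤ c * t ^ 4 / (t ^ 4 * n) := by
  rw [mul_comm c, mul_div_mul_left c n (pow_ne_zero 4 ht.ne')]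
  exact div_le_div_of_nonneg_right hac hn.le

/-- [folklore] arithmetic of the exterior shell-row shape at degree `4`: `a·e/t ≤ c·t³/t⁴·e` when `a ≤ c`, `e ≥ 0`. -/
theorem tail_shape_le {a c e t : ℝ} (ht : 0 < t) (he : 0 ≤ e) (hac : a ≤ c) : a * e / t ≤ c * t ^ 3 / t ^ 4 * e := by
  have h4 : c * t ^ 3 / t ^ 4 = c / t := by
    rw [show t ^ 4 = t ^ 3 * t by ring, mul_comm c, mul_div_mul_left c t (pow_ne_zero 3 ht.ne')]
  rw [h4, div_mul_eq_mul_div]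
  exact div_le_div_of_nonneg_right (mul_le_mul_of_nonneg_right hac he) ht.le

/-- [folklore] arithmetic of the window shell-row shape at degree `3` from a pointwise gradient row:
`80t³·(d/n³) ≤ 80d·t⁴/(t³·n)` for `0 < t ≤ n`, `d ≥ 0`. -/
theorem grad_shape_le {d t n : ℝ} (ht : 0 < t) (hn : 0 < n) (htn : t ≤ n) (hd : 0 ≤ d) :
    80 * t ^ 3 * (d / n ^ 3) ≤ 80 * d * t ^ 4 / (t ^ 3 * n) := by
  have h4 : 80 * d * t ^ 4 / (t ^ 3 * n) = 80 * d * t / n := by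
    rw [show (80 : ℝ) * d * t ^ 4 = t ^ 3 * (80 * d * t) by ring, mul_div_mul_left _ n (pow_ne_zero 3 ht.ne')]
  rw [h4, show 80 * t ^ 3 * (d / n ^ 3) = 80 * d * t ^ 3 / n ^ 3 by ring, div_le_div_iff₀ (by positivity) hn]
  have h2 : t ^ 2 ≤ n ^ 2 := pow_le_pow_left₀ ht.le htn 2
  calc 80 * d * t ^ 3 * n = (80 * d * t * n) * t ^ 2 := by ring
    _ ≤ (80 * d * t * n) * n ^ 2 := mul_le_mul_of_nonneg_left h2 (by positivity)
    _ = 80 * d * t * n ^ 3 := by ring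

end Stencils

end

end Summit.QuantumFields.BalabanUV.Beta.D1BFx.ShellStencils
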